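import Summits.QuantumFields.YangMills.Theorems.UnitScaleTiltHalvingStubOfHP1RoomRho5
import Summits.QuantumFields.YangMills.Theorems.UnitScaleTiltHalvingP1FlatPillarRoomOfSuppliersRho5
import Summits.QuantumFields.YangMills.Theorems.UnitScaleTiltHalvingHSupURho5OfStokesRowS
import Summits.QuantumFields.YangMills.Theorems.UnitScaleTiltHalvingHStokesRowClosure
import Literature.MathematicalPhysics.QuantumFieldTheory.Balaban1983to89.B11Prop8Assembly
import HarnessLib

/-!
# Route `UnitScaleTilt`, crux K1 child «MinimiserStabilityRegPr» (stmt-QuantumFields-19200) — **[Balaban1985Variational] SECT. F ∕ PROP. 8 IN STATIONARITY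
# CURRENCY, HYPOTHESIS-FREE BY NAME, FOR ROOMY MEMBERS**: the one-step halving and its iteration down to `𝔘_k(B₃ε₁)` for every configuration `U ∈ (6)(ε₀) ∩ 𝔅_k(V)`
# that is STATIONARY for the Wilson action along the differentiable curves of the descent fibre — print's reading «we will use only the fact that they are critical
# configurations of the functional (5) and that they belong to the spaces (6) with ε₀ sufficiently small» (p. 300), which is STRONGER than the registered reading R2
# (`IsCritical` := minimiser over some open regular fibre) of the landed stub `stub_halvingStep` (✓p705908).

Cell `ym3-torus` (HUMAN RULING D-0037, YM ladder rung R3 — YM₃ on T³ is a RUNG, NOT d = 4, NOT the Clay problem; the YM mass gap is NOT proved).  Fleet lead seat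
`ym-ust-19200-p1` gen 24 (chair of the 19200 positivity knit).  THEOREMS ONLY (0 `def`, 0 `sorry`, standard axioms); `--supports stmt-QuantumFields-19200 --as helper`,
count-neutral.  Nothing of the stub EX `stub_existenceMinimalOrbit`, the crux, the rung or the gap is claimed.

WHY.  Line H proved the registered halving stub through the ROOM THEOREM IN STATIONARITY CURRENCY ✓`HalvingStubOfHP1RoomRho5.roomHalvingStat_of_rows_rho5 (hP2) (hP1roomρ5)
(hCEgrowth)` whose three displayed texts are all inhabited in the tree (✓`FlatOpsAdmAtMSAllL.hP2_holds`, ✓`HalvingP1FlatPillarRoomOfSuppliersRho5.hP1roomρ5_of_suppliers` ∘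
✓`HalvingHSupURho5OfStokesRowS.hSupUρ5_of_stokesRowS` ∘ ✓`HalvingHStokesRowClosure.hStokesL_holds`, ✓`HalvingSitePackage.ceRows_of_chart_stat_growth_room`), but the
composition is consumed only INSIDE the stub assembly ✓`MinimiserStabilityRegPrStubHalvingStep.stub_halvingStep`, whose statement is the weaker R2 text.  This file records the
hypothesis-free stationarity-currency theorem BY NAME (§1) and iterates it (§2): a stationary configuration of (5) on the fibre lying in `𝔘_k(ε₀)`, `0 < ε₀ ≤ a₅`, lies in
`𝔘_k(B₃ε₁)` — Prop. 8 for CRITICAL (not necessarily minimal) configurations, at every member with room `N ≤ L^{m+n}`.  Consumers: route (β) of EX (a closed-fibre minimiser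
satisfies the two-sided Euler–Lagrange equation along every fibre curve supported away from its active shell; see `Prop7ClosedFibreEulerLagrange`), and any use of print's
Prop. 7 (i) ∕ Sect. G where critical-but-not-minimal configurations occur.  Small members (no room) are reached by the (b7) cover lift only in the R2 reading
(✓`SmallMembersCoverLiftTangent.statLift` takes `IsCritR2`); a stationarity-currency cover lift is NOT claimed here.

WHAT IS PROVED (ns `Summit.QuantumFields.YangMills.Theorems.Prop8StationaryRoom`).
* §1 ★★ `roomHalvingStat_holds` — ✓`roomHalvingStat_of_rows_rho5`'s conclusion VERBATIM with its three texts discharged by name (F n K form); ★ `roomHalvingTextStat_holds` —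
  the same in the carrier letters `famX L i` (✓`HalvingStepOfPillarsRoomStatDoor.roomStubTextStat_of_roomHalvingStat`).
* §2 ★★★ `prop8Stat_holds` — THE ITERATION: same binders, conclusion `RegPr F n K (B₃ * ε₁) U` («We continue this way until we reach the bound B₃ε₁», p. 304), by
  induction on the number of halvings (`RegPr (max (B₃ε₁) (ε₀/2^k)) U` for every `k`, the stationarity hypothesis being radius-free; radius arithmetic = lit
  ✓`B11Prop8Assembly.max_half_le`∕`stage_le`, termination = lit ✓`B11.halving_reaches_B3eps1`);
  ★ `prop8Stat_regFibrePr` — the same read as membership `U ∈ regFibrePr F n K _ (B₃ε₁) V`.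

HONEST SCOPE.  Composition of landed theorems + the lit radius arithmetic of `B11Prop8Assembly`; no new estimate; nothing of [Balaban1985Variational] beyond what line H landed is asserted.

References: T. Bałaban, CMP **102** (1985) 277–309 [Balaban1985Variational] ((2)–(6) p.278, Sect. F pp.300–304, Prop. 8 p.304); CMP **99** (1985) 75–102
[Balaban1985RegularSpaces] (Thm 2 p.83); CMP **99** (1985) 389–434 [Balaban1985BackgroundPropagators] (Thm 3.1 p.397).
-/

set_option autoImplicit false

noncomputable section

open scoped BigOperators Matrix.Norms.L2Operator

namespace Summit.QuantumFields.YangMills.Theorems.Prop8StationaryRoom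

open Literature.MathematicalPhysics.QuantumFieldTheory.Balaban1983to89
open Literature.MathematicalPhysics.QuantumFieldTheory.Balaban1983to89.T3ContinuumYM3Torus
open Literature.MathematicalPhysics.QuantumFieldTheory.Balaban1983to89.T3PrintedRegularMinimiser
open Literature.MathematicalPhysics.QuantumFieldTheory.Balaban1983to89.T3PrintedMinimiserExistence
open Literature.MathematicalPhysics.QuantumFieldTheory.Balaban1983to89.T3Thm1Carrier
open Literature.MathematicalPhysics.QuantumFieldTheory.Balaban1983to89.T3UnitLawDensityEML (ℰp)
open Literature.MathematicalPhysics.QuantumFieldTheory.Balaban1983to89.T3ConstrainedMinimiser (fibre)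
open HalvingStubOfHP1RoomRho5 (roomHalvingStat_of_rows_rho5)
open HalvingStepOfPillarsRoomStatDoor (roomStubTextStat_of_roomHalvingStat)
open FlatOpsAdmAtMSAllL (hP2_holds)
open HalvingP1FlatPillarRoomOfSuppliersRho5 (hP1roomρ5_of_suppliers)
open HalvingHSupURho5OfStokesRowS (hSupUρ5_of_stokesRowS)
open HalvingHStokesRowClosure (hStokesL_holds)
open HalvingSitePackage (ceRows_of_chart_stat_growth_room)
open B11Prop8Assembly (max_half_le stage_le)
open B11 (halving_reaches_B3eps1)

/-! ## §1 The room halving in stationarity currency, hypothesis-free -/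

/-- ★★ **[Balaban1985Variational] SECT. F ONE-STEP HALVING IN STATIONARITY CURRENCY, ROOMY MEMBERS, NO DISPLAYED HYPOTHESIS**: for every block size `L > 1` there are
`N`, `B₃ > 4`, `a₅ > 0` such that for every member `F` (`F.L = L`), heights `n < K` with room `N ≤ L^{m+n}`, every `0 < ε₁`, `0 < ε₀ ≤ a₅`, every (7)-datum `V`
(`|V(∂p) − 1| < ε₁`) and every `U ∈ (6)(ε₀) ∩ 𝔅_k(V)` at which the Wilson action is STATIONARY along every bondwise-differentiable curve of the descent fibre through `U`,
`U ∈ 𝔘_k(max{B₃ε₁, ½ε₀})` (both clauses of (2)).  (= ✓`roomHalvingStat_of_rows_rho5` with ✓`hP2_holds`, ✓`hP1roomρ5_of_suppliers (hSupUρ5_of_stokesRowS hStokesL_holds hStokesL_holds)`,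
✓`ceRows_of_chart_stat_growth_room`.) [cite: Balaban1985Variational, Sect. F p.300 and p.304 (before Prop. 8)] -/
theorem roomHalvingStat_holds :
    ∀ L : ℕ, 1 < L → ∃ (N : ℕ) (B₃ a₅ : ℝ), 4 < B₃ ∧ 0 < a₅ ∧
      ∀ F : T3Family, F.L = L → ∀ (n K : ℕ) (hnK : n < K), N ≤ F.L ^ (F.m + n) →
        ∀ (ε₀ ε₁ : ℝ), 0 < ε₁ → 0 < ε₀ → ε₀ ≤ a₅ →
          ∀ V : GaugeField (F.P n) 0 (Matrix.specialUnitaryGroup (Fin 2) ℂ), PlaqSmall ε₁ V →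
            ∀ U ∈ regFibrePr F n K hnK.le ε₀ V,
              (∀ γ : ℝ → GaugeField (F.P K) 0 (Matrix.specialUnitaryGroup (Fin 2) ℂ), γ 0 = U → (∀ t, γ t ∈ fibre F ℰp n K hnK.le V) →
                (∀ b, DifferentiableAt ℝ (fun t => ((γ t b : Matrix.specialUnitaryGroup (Fin 2) ℂ) : Matrix (Fin 2) (Fin 2) ℂ)) 0) →
                  deriv (fun t => wilsonAction4 (γ t)) 0 = 0) →
                RegPr F n K (max (B₃ * ε₁) (ε₀ / 2)) U :=
  roomHalvingStat_of_rows_rho5 hP2_holds (hP1roomρ5_of_suppliers (hSupUρ5_of_stokesRowS hStokesL_holds hStokesL_holds))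
    ceRows_of_chart_stat_growth_room

/-- ★ The same in the carrier letters `famX L i` of `T3Thm1Carrier` (the `RoomHalvingTextStat` shape consumed by the (b7) cover-lift package
✓`SmallMembersCoverLiftStub.stub_of_roomHalvingStat`), hypothesis-free. [cite: Balaban1985Variational, Sect. F p.304 (before Prop. 8)] -/
theorem roomHalvingTextStat_holds :
    ∀ (L : ℕ), 1 < L → ∃ B₃ : ℝ, 4 < B₃ ∧ ∃ a₅ : ℝ, 0 < a₅ ∧ ∃ N : ℕ,
      ∀ (i : Idx L), N ≤ (i.1.1).L ^ ((i.1.1).m + i.1.2.1) → ∀ (ε₀ ε₁ : ℝ), 0 < ε₁ → ∀ (V : (famX L i).Bdry) (U : (famX L i).Cfg),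
        (famX L i).Reg7 ε₁ V → (famX L i).InU ε₀ U → (famX L i).InB V U →
        (∀ γ : ℝ → GaugeField ((i.1.1).P i.1.2.2) 0 (Matrix.specialUnitaryGroup (Fin 2) ℂ), γ 0 = U → (∀ t, γ t ∈ fibre i.1.1 ℰp i.1.2.1 i.1.2.2 i.2.2.le V) →
          (∀ b, DifferentiableAt ℝ (fun t => ((γ t b : Matrix.specialUnitaryGroup (Fin 2) ℂ) : Matrix (Fin 2) (Fin 2) ℂ)) 0) →
            deriv (fun t => wilsonAction4 (γ t)) 0 = 0) → ε₀ ≤ a₅ →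
          (famX L i).InU (max (B₃ * ε₁) (ε₀ / 2)) U :=
  roomStubTextStat_of_roomHalvingStat roomHalvingStat_holds

/-! ## §2 The iteration: Prop. 8 for stationary configurations («We continue this way until we reach the bound B₃ε₁») -/

/-- ★★★ **PROP. 8 FOR STATIONARY CONFIGURATIONS (roomy members)**: with the constants of `roomHalvingStat_holds`, every `U ∈ (6)(ε₀) ∩ 𝔅_k(V)`, `0 < ε₀ ≤ a₅`, stationary for
the Wilson action along every differentiable fibre curve, lies in `𝔘_k(B₃ε₁)` — the halving iterated (the stationarity hypothesis does not mention the radius, so each halved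
radius `max{B₃ε₁, ε₀/2^k} ≤ ε₀ ≤ a₅` is again admissible), then `ε₀/2^k ≤ B₃ε₁` for `k` large. [cite: Balaban1985Variational, Prop. 8 p.304] -/
theorem prop8Stat_holds :
    ∀ L : ℕ, 1 < L → ∃ (N : ℕ) (B₃ a₅ : ℝ), 4 < B₃ ∧ 0 < a₅ ∧
      ∀ F : T3Family, F.L = L → ∀ (n K : ℕ) (hnK : n < K), N ≤ F.L ^ (F.m + n) →
        ∀ (ε₀ ε₁ : ℝ), 0 < ε₁ → 0 < ε₀ → ε₀ ≤ a₅ →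
          ∀ V : GaugeField (F.P n) 0 (Matrix.specialUnitaryGroup (Fin 2) ℂ), PlaqSmall ε₁ V →
            ∀ U ∈ regFibrePr F n K hnK.le ε₀ V,
              (∀ γ : ℝ → GaugeField (F.P K) 0 (Matrix.specialUnitaryGroup (Fin 2) ℂ), γ 0 = U → (∀ t, γ t ∈ fibre F ℰp n K hnK.le V) →
                (∀ b, DifferentiableAt ℝ (fun t => ((γ t b : Matrix.specialUnitaryGroup (Fin 2) ℂ) : Matrix (Fin 2) (Fin 2) ℂ)) 0) →
                  deriv (fun t => wilsonAction4 (γ t)) 0 = 0) →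
                RegPr F n K (B₃ * ε₁) U := by
  intro L hL
  obtain ⟨N, B₃, a₅, hB₃, ha₅, H⟩ := roomHalvingStat_holds L hL
  refine ⟨N, B₃, a₅, hB₃, ha₅, fun F hF n K hnK hN ε₀ ε₁ hε₁ hε₀ hε₀a V hV U hU hstat => ?_⟩
  have hb : 0 < B₃ * ε₁ := mul_pos (by linarith) hε₁
  have hfib : U ∈ fibre F ℰp n K hnK.le V := ((mem_regFibrePr_iff F).mp hU).1
  have hreg : RegPr F n K ε₀ U := ((mem_regFibrePr_iff F).mp hU).2
  -- every halved radius
  have hiter : ∀ k : ℕ, RegPr F n K (max (B₃ * ε₁) (ε₀ / 2 ^ k)) U := by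
    intro k
    induction k with
    | zero => exact regPr_mono F (by rw [pow_zero, div_one]; exact le_max_right _ _) hreg
    | succ k ih =>
      -- the current radius is positive and at most `ε₀ ≤ a₅` unless the target is already reached
      by_cases hle : ε₀ ≤ B₃ * ε₁
      · exact regPr_mono F (hle.trans (le_max_left _ _)) hreg
      · have hek_pos : 0 < max (B₃ * ε₁) (ε₀ / 2 ^ k) := lt_max_of_lt_left hb
        have hek_le : max (B₃ * ε₁) (ε₀ / 2 ^ k) ≤ a₅ := (stage_le (le_of_lt (lt_of_not_ge hle)) hε₀.le k).trans hε₀a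
        have hUk : U ∈ regFibrePr F n K hnK.le (max (B₃ * ε₁) (ε₀ / 2 ^ k)) V := (mem_regFibrePr_iff F).mpr ⟨hfib, ih⟩
        have hstep := H F hF n K hnK hN _ ε₁ hε₁ hek_pos hek_le V hV U hUk hstat
        exact regPr_mono F (max_half_le hb.le k) hstep
  obtain ⟨k, hk⟩ := halving_reaches_B3eps1 ε₀ (B₃ * ε₁) hb
  have := hiter k
  rwa [hk] at this

/-- ★ The same read as membership in print's regular fibre `(6)(B₃ε₁) ∩ 𝔅_k(V)`. [cite: Balaban1985Variational, Thm 1 (8) p.279, Prop. 8 p.304] -/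
theorem prop8Stat_regFibrePr :
    ∀ L : ℕ, 1 < L → ∃ (N : ℕ) (B₃ a₅ : ℝ), 4 < B₃ ∧ 0 < a₅ ∧
      ∀ F : T3Family, F.L = L → ∀ (n K : ℕ) (hnK : n < K), N ≤ F.L ^ (F.m + n) →
        ∀ (ε₀ ε₁ : ℝ), 0 < ε₁ → 0 < ε₀ → ε₀ ≤ a₅ →
          ∀ V : GaugeField (F.P n) 0 (Matrix.specialUnitaryGroup (Fin 2) ℂ), PlaqSmall ε₁ V →
            ∀ U ∈ regFibrePr F n K hnK.le ε₀ V,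
              (∀ γ : ℝ → GaugeField (F.P K) 0 (Matrix.specialUnitaryGroup (Fin 2) ℂ), γ 0 = U → (∀ t, γ t ∈ fibre F ℰp n K hnK.le V) →
                (∀ b, DifferentiableAt ℝ (fun t => ((γ t b : Matrix.specialUnitaryGroup (Fin 2) ℂ) : Matrix (Fin 2) (Fin 2) ℂ)) 0) →
                  deriv (fun t => wilsonAction4 (γ t)) 0 = 0) →
                U ∈ regFibrePr F n K hnK.le (B₃ * ε₁) V := by
  intro L hL
  obtain ⟨N, B₃, a₅, hB₃, ha₅, H⟩ := prop8Stat_holds L hL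
  refine ⟨N, B₃, a₅, hB₃, ha₅, fun F hF n K hnK hN ε₀ ε₁ hε₁ hε₀ hε₀a V hV U hU hstat => ?_⟩
  exact (mem_regFibrePr_iff F).mpr ⟨((mem_regFibrePr_iff F).mp hU).1, H F hF n K hnK hN ε₀ ε₁ hε₁ hε₀ hε₀a V hV U hU hstat⟩

end Summit.QuantumFields.YangMills.Theorems.Prop8StationaryRoom

end
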